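import Mathlib
import Summits.CriticalPhenomena.CardyFormulaZ2.Theorems.CardyMagicRigidityLoopsToCrossingsStubComparisonGeometry
import Literature.Probability.RandomPlanarGeometry.CollarGeometry
import HarnessLib

/-!
# Stub `stub_siteEndCrossings` (S7a), line `Sketch`, crux `LoopLimitZ2EqT` (stmt-CriticalPhenomena-4833):
# the comparison rectangle in sandwich position, with its collar clauses

Helper file (`--supports stmt-CriticalPhenomena-4833`). For a conformal rectangle
`R = (Ω; P₀, P₁, P₂, P₃)` and a closeness budget `ε₀ > 0` we rebuild, for every plate margin
`t > 0`, the LOWER comparison rectangle `Q` of Bollobás–Riordan (*Percolation* (2006), Ch. 7,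
Lemma 14 p. 184 and Fig. 14 p. 186) exactly as in `exists_lowerQuad`
(`CardyMagicRigidityLoopsToCrossingsStubComparisonGeometry.lean`: profile loop `u ↦ T.tube (p u) u`
of a two-plateau trapezoid profile, high plateau `1 + θ` over the arcs `0, 2` and the corners, low
plateau `1 - h` along the arcs `1, 3`, re-marked by `s`), and record TWO MORE clauses of its
position, needed to use the same rectangle from the inside (as an UPPER comparison rectangle of the
cyclically re-marked `R`):

* (L5) every point of `Ω` off `Q` is within `2ε₀` of `Q.arc 1 ∪ Q.arc 3` (it is a tube point
  `tube σ u` with `p u ≤ σ < 1`, `ProfileCollar.lean`, so `u` is off the high plateaus);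
* (L6) `Q.arc i ⊆ cthickening (2ε₀) (R.arc i)` for every `i` (the loop is `ε₀`-close to `∂Ω(u)` and
  the re-marking moves the arc ranges by `s`, below the `ε₀`-continuity modulus of the boundary loop).
-/

noncomputable section

open Set Metric Filter Topology

namespace Summit.CriticalPhenomena.CardyFormulaZ2.Cruxes.LoopLimitZ2EqT.HexSegment

open Literature.Probability.RandomPlanarGeometry

/-- A `1`-periodic function takes the same value at the window representative
`m + fract (u - m) ∈ [m, m + 1)` of `u`. -/
theorem siteEndCrossings_apply_window {β : Type*} {f : ℝ → β} (hf : Function.Periodic f 1) (m u : ℝ) :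
    f (m + Int.fract (u - m)) = f u := by
  have := hf.sub_int_mul_eq (x := u) ⌊u - m⌋
  rw [mul_one] at this
  rw [← this, Int.fract]
  congr 1
  ring

/-- **The lower comparison rectangle of a conformal rectangle, with its collar clauses.** For every
conformal rectangle `R` and `ε₀ > 0` there is a lateral margin `m > 0` such that for every plate
margin `t > 0` there are a conformal rectangle `Q` and a room `r > 0` with: boundary loop and marks
`ε₀`-close to those of `R`; (L1) points of the `r`-fattening of `Q` off `Ω` are `t`-close to
`R.arc 0 ∪ R.arc 2`; (L2) points of it in `Ω` are `m`-far from `R.arc 1 ∪ R.arc 3`; (L3)/(L4) the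
`r`-fattenings of `Q.arc 0`, `Q.arc 2` are off `Ω` and `t`-close to `R.arc 0`, resp. `R.arc 2`;
(L5) points of `Ω` off `Q` are `2ε₀`-close to `Q.arc 1 ∪ Q.arc 3`; (L6)
`Q.arc i ⊆ cthickening (2ε₀) (R.arc i)`. Construction of `exists_lowerQuad` (trapezoid profile
collar, Bollobás–Riordan, *Percolation* (2006), Ch. 7 Lemma 14 p. 184, Fig. 14 p. 186) verbatim,
plus the two inner clauses. -/
theorem siteEndCrossings_exists_lowerQuad : ∀ (R : ConformalRectangle) {ε₀ : ℝ}, 0 < ε₀ →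
    ∃ m : ℝ, 0 < m ∧ ∀ t : ℝ, 0 < t →
    ∃ (Q : ConformalRectangle) (r : ℝ), 0 < r ∧
      (∀ u : ℝ, dist (Q.boundary u) (R.boundary u) ≤ ε₀) ∧
      (∀ i : Fin 4, |Q.mark i - R.mark i| ≤ ε₀) ∧
      (∀ z ∈ cthickening r Q.carrier, z ∉ R.carrier → infDist z (R.arc 0) ≤ t ∨ infDist z (R.arc 2) ≤ t) ∧
      (∀ z ∈ cthickening r Q.carrier, z ∈ R.carrier → m ≤ infDist z (R.arc 1) ∧ m ≤ infDist z (R.arc 3)) ∧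
      (∀ z ∈ cthickening r (Q.arc 0), z ∉ R.carrier ∧ infDist z (R.arc 0) ≤ t) ∧
      (∀ z ∈ cthickening r (Q.arc 2), z ∉ R.carrier ∧ infDist z (R.arc 2) ≤ t) ∧
      (∀ z ∈ R.carrier, z ∉ Q.carrier → infDist z (Q.arc 1) ≤ 2 * ε₀ ∨ infDist z (Q.arc 3) ≤ 2 * ε₀) ∧
      (∀ i : Fin 4, Q.arc i ⊆ cthickening (2 * ε₀) (R.arc i)) := by
  intro R ε₀ hε₀
  obtain ⟨h0, h1, h2, h3, h4⟩ := R.marks_chain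
  obtain ⟨n0, n1, n2, n3⟩ := R.nextMarks_eq
  have hm1 := (R.mark_mem 1).2; have hm3 := (R.mark_mem 3).2
  obtain ⟨T⟩ := R.toJordanDomain.nonempty_tubeData
  -- the `ε₀`-continuity modulus of the boundary loop
  obtain ⟨Δ, hΔ, hmod⟩ := R.exists_dist_boundary_lt hε₀
  -- the room `s` (from `ε₀`, `Δ` and the mark gaps)
  obtain ⟨s, hs0, hsε, hsΔ, hs1, hs2, hs3, hs4⟩ : ∃ s : ℝ, 0 < s ∧ s ≤ ε₀ ∧ s < Δ ∧ 4 * s ≤ R.mark 1 - R.mark 0 ∧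
      4 * s ≤ R.mark 2 - R.mark 1 ∧ 4 * s ≤ R.mark 3 - R.mark 2 ∧ 4 * s ≤ R.mark 0 + 1 - R.mark 3 := by
    set g := min (min (R.mark 1 - R.mark 0) (R.mark 2 - R.mark 1)) (min (R.mark 3 - R.mark 2) (R.mark 0 + 1 - R.mark 3))
      with hg
    have hg0 : 0 < g := lt_min (lt_min (by linarith) (by linarith)) (lt_min (by linarith) (by linarith))
    have hg1 : g ≤ R.mark 1 - R.mark 0 := (min_le_left _ _).trans (min_le_left _ _)
    have hg2 : g ≤ R.mark 2 - R.mark 1 := (min_le_left _ _).trans (min_le_right _ _)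
    have hg3 : g ≤ R.mark 3 - R.mark 2 := (min_le_right _ _).trans (min_le_left _ _)
    have hg4 : g ≤ R.mark 0 + 1 - R.mark 3 := (min_le_right _ _).trans (min_le_right _ _)
    have a1 : min (min ε₀ (Δ / 2)) (g / 4) ≤ ε₀ := (min_le_left _ _).trans (min_le_left _ _)
    have a2 : min (min ε₀ (Δ / 2)) (g / 4) ≤ Δ / 2 := (min_le_left _ _).trans (min_le_right _ _)
    have a3 : min (min ε₀ (Δ / 2)) (g / 4) ≤ g / 4 := min_le_right _ _
    exact ⟨min (min ε₀ (Δ / 2)) (g / 4), by positivity, a1, by linarith, by linarith, by linarith, by linarith,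
      by linarith⟩
  -- separation of the non-low boundary points from the banned arcs (from `s`)
  obtain ⟨d₀, hd₀, hsep⟩ := R.exists_sep_arcs (κ := s / 8) (by linarith)
  -- the width `h` (from `ε₀`, the depth of the centre and `d₀`)
  have hρ₀ := R.toJordanDomain.infDist_frontier_pos T.hz₀
  obtain ⟨h, hh, hh1, htol⟩ := T.exists_dist_tube_lt (ε := min (min ε₀ (infDist T.z₀ (frontier R.carrier))) (d₀ / 4))
    (lt_min (lt_min hε₀ hρ₀) (by linarith))
  have htol1 : ∀ σ u, 1 - h ≤ σ → σ ≤ 1 + h → dist (T.tube σ u) (R.boundary u) < ε₀ := fun σ u ha hb =>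
    (htol σ u ha hb).trans_le ((min_le_left _ _).trans (min_le_left _ _))
  have htol2 : ∀ σ u, 1 - h ≤ σ → σ ≤ 1 + h → dist (T.tube σ u) (R.boundary u) < infDist T.z₀ (frontier R.carrier) :=
    fun σ u ha hb => (htol σ u ha hb).trans_le ((min_le_left _ _).trans (min_le_right _ _))
  have htol3 : ∀ σ u, 1 - h ≤ σ → σ ≤ 1 + h → dist (T.tube σ u) (R.boundary u) < d₀ / 4 := fun σ u ha hb =>
    (htol σ u ha hb).trans_le (min_le_right _ _)
  -- the depth of the inner levels (from `h`), and the lateral margin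
  obtain ⟨mi, hmi, hdeep⟩ := T.exists_le_infDist_tube_inner (h := h / 2) (by linarith) (by linarith)
  refine ⟨min mi (d₀ / 2) / 2, by positivity, fun t ht => ?_⟩
  -- per `t`: the poke-out `θ`, the outer margin, the profile
  obtain ⟨θ₁, hθ₁, hθ₁1, htolθ⟩ := T.exists_dist_tube_lt (ε := t / 2) (by linarith)
  obtain ⟨θ, hθ0, hθh, hθθ₁⟩ : ∃ θ : ℝ, 0 < θ ∧ θ ≤ h ∧ θ ≤ θ₁ := ⟨min θ₁ h, lt_min hθ₁ hh, min_le_right _ _, min_le_left _ _⟩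
  obtain ⟨mo, hmo, hout⟩ := T.exists_le_infDist_tube_outer (h := θ) hθ0 (by linarith)
  obtain ⟨p, hpc, hper, hband, hplat, hloc⟩ := exists_trapezoid_profile (a₀ := R.mark 0) (a₁ := R.mark 1)
    (a₂ := R.mark 2) (a₃ := R.mark 3) (s := s) (h := h) (θ := θ) (by linarith) h2.le (by linarith) h4.le hs0 hh hθ0 hθh
  have hp0 : ∀ u, 0 < p u := fun u => by linarith [(hband u).1]
  have hp2 : ∀ u, p u < 2 := fun u => by linarith [(hband u).2]
  -- the quad
  let Q : ConformalRectangle :=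
    { toJordanDomain := JordanDomain.ofLoop (T.continuous_profileLoop hpc hp0 hp2) (T.periodic_profileLoop hper)
        (T.injOn_profileLoop hp0 hp2)
      mark := ![R.mark 0 + s, R.mark 1 - s, R.mark 2 + s, R.mark 3 - s]
      strictMono_mark := Fin.strictMono_iff_lt_succ.2 fun k => by
        fin_cases k
        · show R.mark 0 + s < R.mark 1 - s; linarith
        · show R.mark 1 - s < R.mark 2 + s; linarith
        · show R.mark 2 + s < R.mark 3 - s; linarith
      mark_mem := fun k => by
        fin_cases k
        · show R.mark 0 + s ∈ Ico 0 1; exact ⟨by linarith, by linarith⟩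
        · show R.mark 1 - s ∈ Ico 0 1; exact ⟨by linarith, by linarith⟩
        · show R.mark 2 + s ∈ Ico 0 1; exact ⟨by linarith, by linarith⟩
        · show R.mark 3 - s ∈ Ico 0 1; exact ⟨by linarith, by linarith⟩ }
  have hQf : frontier Q.carrier = range fun u => T.tube (p u) u := JordanDomain.frontier_ofLoop_carrier _ _ _
  obtain ⟨nQ0, nQ1, nQ2, nQ3⟩ := Q.nextMarks_eq
  -- the centre is inside
  have hz₀ : T.z₀ ∈ Q.carrier := T.z₀_mem_of_frontier_eq hpc hper hp0 hp2 Q.toJordanDomain hQf fun u =>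
    htol2 _ _ (hband u).1 (by linarith [(hband u).2])
  -- localisation of the non-low boundary points
  set I : Set ℝ := Icc (R.mark 0 + s / 8) (R.mark 1 - s / 8) ∪ Icc (R.mark 2 + s / 8) (R.mark 3 - s / 8) with hI
  have hbf : ∀ u, R.boundary (R.mark 0 + Int.fract (u - R.mark 0)) = R.boundary u := fun u =>
    siteEndCrossings_apply_window R.periodic_boundary _ u
  have hK : ∀ u, 1 - h / 2 < p u → R.boundary u ∈ R.boundary '' I := fun u hu => by
    rw [← hbf u]
    refine ⟨_, ?_, rfl⟩
    rcases hloc u hu with ⟨ha, hb⟩ | ⟨ha, hb⟩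
    · exact Or.inl ⟨ha.le, hb.le⟩
    · exact Or.inr ⟨ha.le, hb.le⟩
  have hKA : R.boundary '' I ⊆ R.arc 0 ∪ R.arc 2 := by
    rintro _ ⟨u, hu, rfl⟩
    rcases hu with ⟨ha, hb⟩ | ⟨ha, hb⟩
    · exact Or.inl ⟨u, ⟨by linarith, by rw [n0]; linarith⟩, rfl⟩
    · exact Or.inr ⟨u, ⟨by linarith, by rw [n2]; linarith⟩, rfl⟩
  have hKB : ∀ k ∈ R.boundary '' I, ∀ b ∈ R.arc 1 ∪ R.arc 3, d₀ ≤ dist k b := by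
    rintro _ ⟨u, hu, rfl⟩ b hb
    exact hsep u hu b hb
  have hAB : frontier R.carrier ⊆ (R.arc 0 ∪ R.arc 2) ∪ (R.arc 1 ∪ R.arc 3) := by
    intro x hx
    rw [← (R.iUnion_arc_holds : ⋃ i, R.arc i = frontier R.carrier), mem_iUnion] at hx
    obtain ⟨i, hi⟩ := hx
    fin_cases i
    · exact Or.inl (Or.inl hi)
    · exact Or.inr (Or.inl hi)
    · exact Or.inl (Or.inr hi)
    · exact Or.inr (Or.inr hi)
  have hB : R.arc 1 ∪ R.arc 3 ⊆ frontier R.carrier := union_subset (R.arc_subset_frontier 1) (R.arc_subset_frontier 3)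
  -- the room `r`
  obtain ⟨r, hr, hrt, hrmo, hrM⟩ : ∃ r : ℝ, 0 < r ∧ 8 * r ≤ t ∧ 4 * r ≤ mo ∧ 4 * r ≤ min mi (d₀ / 2) :=
    ⟨min (t / 8) (min (mo / 4) (min mi (d₀ / 2) / 4)), by positivity,
      by linarith [min_le_left (t / 8) (min (mo / 4) (min mi (d₀ / 2) / 4))],
      by linarith [min_le_right (t / 8) (min (mo / 4) (min mi (d₀ / 2) / 4)), min_le_left (mo / 4) (min mi (d₀ / 2) / 4)],
      by linarith [min_le_right (t / 8) (min (mo / 4) (min mi (d₀ / 2) / 4)), min_le_right (mo / 4) (min mi (d₀ / 2) / 4)]⟩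
  have hMmi : min mi (d₀ / 2) ≤ mi := min_le_left _ _
  have hMd : min mi (d₀ / 2) ≤ d₀ / 2 := min_le_right _ _
  -- the sandwich clauses
  obtain ⟨hout_cl, hin_cl⟩ := T.sandwich_of_frontier_eq hper hp0 hp2 Q.toJordanDomain hQf
    (A := R.arc 0 ∪ R.arc 2) (B := R.arc 1 ∪ R.arc 3) (K := R.boundary '' I)
    (h' := h / 2) (θ := θ) (tol := d₀ / 4) (tolθ := t / 2) (d₀ := d₀) (mi := mi) (r := r)
    hθ0.le (by linarith) (fun u => (hband u).2) hK hKA hKB hAB hB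
    (fun σ u ha hb => hdeep σ u (abs_le.2 ⟨by linarith, hb⟩))
    (fun σ u ha hb => htol3 σ u (by linarith) (by linarith))
    (fun σ u ha hb => htolθ σ u (by linarith) (by linarith)) hr (by linarith) (by linarith)
  -- the cap clauses
  have hcap : ∀ (I₀ : Set ℝ) (A₀ C : Set ℂ), (∀ u ∈ I₀, R.boundary u ∈ A₀) → C ⊆ (fun u => T.tube (1 + θ) u) '' I₀ →
      ∀ z ∈ cthickening r C, z ∉ R.carrier ∧ infDist z A₀ ≤ t := fun I₀ A₀ C hI₀ hC z hz => by
    obtain ⟨hzΩ, a, ha, hza⟩ := T.cap_of_subset_image (θ' := θ) (mo := mo) (tolθ := t / 2) (r := r)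
      (fun u => hout _ u le_rfl (by linarith)) (fun u => htolθ _ u (by linarith) (by linarith)) hI₀ hC hr (by linarith) z hz
    exact ⟨hzΩ, (infDist_le_dist_of_mem ha).trans (by linarith)⟩
  -- the boundary closeness
  have hQb : ∀ u, dist (T.tube (p u) u) (R.boundary u) < ε₀ := fun u => htol1 _ _ (hband u).1 (by linarith [(hband u).2])
  refine ⟨Q, r, hr, fun u => (hQb u).le, fun i => ?_, fun z hz hzΩ => ?_, fun z hz hzΩ => ?_, ?_, ?_, fun z hz hzQ => ?_,
    fun i => ?_⟩
  · -- marks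
    fin_cases i
    · show |R.mark 0 + s - R.mark 0| ≤ ε₀; rw [add_sub_cancel_left, abs_of_pos hs0]; exact hsε
    · show |R.mark 1 - s - R.mark 1| ≤ ε₀; rw [sub_sub_cancel_left, abs_neg, abs_of_pos hs0]; exact hsε
    · show |R.mark 2 + s - R.mark 2| ≤ ε₀; rw [add_sub_cancel_left, abs_of_pos hs0]; exact hsε
    · show |R.mark 3 - s - R.mark 3| ≤ ε₀; rw [sub_sub_cancel_left, abs_neg, abs_of_pos hs0]; exact hsε
  · -- off `Ω`: near an allowed arc
    obtain ⟨a, ha, hza⟩ := hout_cl z hz hzΩ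
    rcases ha with ha | ha
    · exact Or.inl ((infDist_le_dist_of_mem ha).trans (by linarith))
    · exact Or.inr ((infDist_le_dist_of_mem ha).trans (by linarith))
  · -- in `Ω`: off the banned arcs
    have key := hin_cl z hz hzΩ
    have hle : min mi (d₀ / 2) / 2 ≤ min mi (d₀ - d₀ / 4) - 2 * r := by
      have := min_le_min (le_refl mi) (show d₀ / 2 ≤ d₀ - d₀ / 4 by linarith)
      linarith
    exact ⟨(le_infDist ⟨R.pt 1, R.pt_mem_arc_self 1⟩).2 fun b hb => hle.trans (key b (Or.inl hb)),
      (le_infDist ⟨R.pt 3, R.pt_mem_arc_self 3⟩).2 fun b hb => hle.trans (key b (Or.inr hb))⟩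
  · -- the cap over arc `0`
    refine hcap (Icc (R.mark 0 + s) (R.mark 1 - s)) (R.arc 0) (Q.arc 0)
      (fun u hu => ⟨u, ⟨by linarith [hu.1], by rw [n0]; linarith [hu.2]⟩, rfl⟩) ?_
    rintro _ ⟨u, hu, rfl⟩
    rw [nQ0] at hu
    change u ∈ Icc (R.mark 0 + s) (R.mark 1 - s) at hu
    refine ⟨u, hu, ?_⟩
    show T.tube (1 + θ) u = T.tube (p u) u
    rw [hplat u (Or.inl ⟨by linarith [hu.1], by linarith [hu.2]⟩)]
  · -- the cap over arc `2`
    refine hcap (Icc (R.mark 2 + s) (R.mark 3 - s)) (R.arc 2) (Q.arc 2)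
      (fun u hu => ⟨u, ⟨by linarith [hu.1], by rw [n2]; linarith [hu.2]⟩, rfl⟩) ?_
    rintro _ ⟨u, hu, rfl⟩
    rw [nQ2] at hu
    change u ∈ Icc (R.mark 2 + s) (R.mark 3 - s) at hu
    refine ⟨u, hu, ?_⟩
    show T.tube (1 + θ) u = T.tube (p u) u
    rw [hplat u (Or.inr ⟨by linarith [hu.1], by linarith [hu.2]⟩)]
  · -- (L5): points of `Ω` off `Q` are near `Q.arc 1 ∪ Q.arc 3`
    have hD1 : frontier R.carrier = range fun u => T.tube ((fun _ : ℝ => (1 : ℝ)) u) u := by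
      rw [← R.range_boundary]
      congr 1
      funext u
      exact (T.tube_one u).symm
    obtain ⟨w, u, hw1, hzw, hray⟩ := T.exists_eq_tube_of_mem_of_mem' (p := fun _ : ℝ => (1 : ℝ)) (fun _ => rfl)
      (fun _ => one_pos) (fun _ => one_lt_two) R.toJordanDomain hD1 hz hz
    rcases eq_or_ne w 0 with rfl | hw0
    · rw [T.Ci_zero] at hzw
      exact (hzQ (hzw ▸ hz₀)).elim
    obtain ⟨-, hzt, -⟩ := hray hw0
    have hpw : p u ≤ ‖w‖ := by
      by_contra hlt
      push Not at hlt
      exact hzQ (hzt ▸ T.tube_mem_of_frontier_eq hper hp0 hp2 Q.toJordanDomain hQf hz₀ (norm_nonneg w) hlt)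
    have hpu1 : p u < 1 := hpw.trans_lt hw1
    have hdz : dist z (T.tube (p u) u) < 2 * ε₀ := by
      have d1 : dist (T.tube ‖w‖ u) (R.boundary u) < ε₀ := htol1 _ _ ((hband u).1.trans hpw) (by linarith)
      have d2 := hQb u
      rw [hzt]
      rw [dist_comm] at d2
      linarith [dist_triangle (T.tube ‖w‖ u) (R.boundary u) (T.tube (p u) u)]
    -- the window representative of `u` is off the high plateaus
    set u' := R.mark 0 + Int.fract (u - R.mark 0) with hu'
    have hu'0 : R.mark 0 ≤ u' := by have := Int.fract_nonneg (u - R.mark 0); rw [hu']; linarith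
    have hu'1 : u' < R.mark 0 + 1 := by have := Int.fract_lt_one (u - R.mark 0); rw [hu']; linarith
    have hpu' : p u' = p u := siteEndCrossings_apply_window hper _ u
    have hQu' : T.tube (p u') u' = T.tube (p u) u := siteEndCrossings_apply_window (T.periodic_profileLoop hper) _ u
    have hQu'1 : T.tube (p (u' + 1)) (u' + 1) = T.tube (p u') u' := T.periodic_profileLoop hper u'
    have hnot : ¬ (u' ∈ Icc (R.mark 0 + s / 2) (R.mark 1 - s / 2) ∪ Icc (R.mark 2 + s / 2) (R.mark 3 - s / 2)) := fun hmem => by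
      have := hplat u' hmem; rw [hpu'] at this; linarith
    have harc1 : R.mark 1 - s / 2 < u' → u' < R.mark 2 + s / 2 → infDist z (Q.arc 1) ≤ 2 * ε₀ := fun ha hb => by
      refine (infDist_le_dist_of_mem (show T.tube (p u') u' ∈ Q.arc 1 from ⟨u', ⟨?_, ?_⟩, rfl⟩)).trans ?_
      · show R.mark 1 - s ≤ u'; linarith
      · rw [nQ1]; show u' ≤ R.mark 2 + s; linarith
      · rw [hQu']; exact hdz.le
    have harc3 : ∀ v, R.mark 3 - s ≤ v → v ≤ R.mark 0 + s + 1 → T.tube (p v) v = T.tube (p u) u →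
        infDist z (Q.arc 3) ≤ 2 * ε₀ := fun v ha hb hv => by
      refine (infDist_le_dist_of_mem (show T.tube (p v) v ∈ Q.arc 3 from ⟨v, ⟨?_, ?_⟩, rfl⟩)).trans ?_
      · show R.mark 3 - s ≤ v; exact ha
      · rw [nQ3]; show v ≤ R.mark 0 + s + 1; exact hb
      · rw [hv]; exact hdz.le
    by_cases c1 : u' < R.mark 0 + s / 2
    · exact Or.inr (harc3 (u' + 1) (by linarith) (by linarith) (by rw [hQu'1, hQu']))
    by_cases c2 : u' ≤ R.mark 1 - s / 2
    · exact (hnot (Or.inl ⟨not_lt.1 c1, c2⟩)).elim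
    by_cases c3 : u' < R.mark 2 + s / 2
    · exact Or.inl (harc1 (not_le.1 c2) c3)
    by_cases c4 : u' ≤ R.mark 3 - s / 2
    · exact (hnot (Or.inr ⟨not_lt.1 c3, c4⟩)).elim
    · exact Or.inr (harc3 u' (by linarith [not_le.1 c4]) (by linarith) hQu')
  · -- (L6): the arcs of `Q` are `2ε₀`-close to those of `R`
    rintro _ ⟨u, hu, rfl⟩
    -- a parameter of the corresponding arc of `R` within `s` of `u`, both in the window
    obtain ⟨u₁, hu₁, huu₁, hwu, hwu₁⟩ : ∃ u₁ ∈ Icc (R.mark i) (R.nextMark i), |u - u₁| ≤ s ∧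
        u ∈ Icc (R.mark 0 - 1) (R.mark 0 + 2) ∧ u₁ ∈ Icc (R.mark 0 - 1) (R.mark 0 + 2) := by
      fin_cases i <;> simp only [Fin.zero_eta, Fin.isValue, Fin.mk_one, Fin.reduceFinMk] at hu ⊢
      · rw [nQ0] at hu
        change u ∈ Icc (R.mark 0 + s) (R.mark 1 - s) at hu
        refine ⟨u, ⟨by linarith [hu.1], by rw [n0]; linarith [hu.2]⟩, by rw [sub_self, abs_zero]; exact hs0.le,
          ⟨by linarith [hu.1], by linarith [hu.2]⟩, ⟨by linarith [hu.1], by linarith [hu.2]⟩⟩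
      · rw [nQ1] at hu
        change u ∈ Icc (R.mark 1 - s) (R.mark 2 + s) at hu
        refine ⟨max (R.mark 1) (min u (R.mark 2)), ⟨le_max_left _ _, ?_⟩, ?_, ⟨by linarith [hu.1], by linarith [hu.2]⟩,
          ⟨?_, ?_⟩⟩
        · rw [n1]; exact max_le h2.le (min_le_right _ _)
        · rw [abs_le]
          constructor
          · have : max (R.mark 1) (min u (R.mark 2)) ≤ max (R.mark 1) u := max_le_max le_rfl (min_le_left _ _)
            have : max (R.mark 1) u ≤ u + s := max_le (by linarith [hu.1]) (by linarith)
            linarith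
          · have : min u (R.mark 2) ≤ max (R.mark 1) (min u (R.mark 2)) := le_max_right _ _
            have : u - s ≤ min u (R.mark 2) := le_min (by linarith) (by linarith [hu.2])
            linarith
        · linarith [le_max_left (R.mark 1) (min u (R.mark 2))]
        · linarith [max_le h2.le (min_le_right u (R.mark 2))]
      · rw [nQ2] at hu
        change u ∈ Icc (R.mark 2 + s) (R.mark 3 - s) at hu
        refine ⟨u, ⟨by linarith [hu.1], by rw [n2]; linarith [hu.2]⟩, by rw [sub_self, abs_zero]; exact hs0.le,
          ⟨by linarith [hu.1], by linarith [hu.2]⟩, ⟨by linarith [hu.1], by linarith [hu.2]⟩⟩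
      · rw [nQ3] at hu
        change u ∈ Icc (R.mark 3 - s) (R.mark 0 + s + 1) at hu
        refine ⟨max (R.mark 3) (min u (R.mark 0 + 1)), ⟨le_max_left _ _, ?_⟩, ?_, ⟨by linarith [hu.1], by linarith [hu.2]⟩,
          ⟨?_, ?_⟩⟩
        · rw [n3]; exact max_le h4.le (min_le_right _ _)
        · rw [abs_le]
          constructor
          · have : max (R.mark 3) (min u (R.mark 0 + 1)) ≤ max (R.mark 3) u := max_le_max le_rfl (min_le_left _ _)
            have : max (R.mark 3) u ≤ u + s := max_le (by linarith [hu.1]) (by linarith)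
            linarith
          · have : min u (R.mark 0 + 1) ≤ max (R.mark 3) (min u (R.mark 0 + 1)) := le_max_right _ _
            have : u - s ≤ min u (R.mark 0 + 1) := le_min (by linarith) (by linarith [hu.2])
            linarith
        · linarith [le_max_left (R.mark 3) (min u (R.mark 0 + 1))]
        · linarith [max_le h4.le (min_le_right u (R.mark 0 + 1))]
    have hd1 : dist (T.tube (p u) u) (R.boundary u) < ε₀ := hQb u
    have hd2 : dist (R.boundary u) (R.boundary u₁) < ε₀ := hmod u u₁ hwu hwu₁ (huu₁.trans_lt hsΔ)
    refine mem_cthickening_of_dist_le _ (R.boundary u₁) _ _ ⟨u₁, hu₁, rfl⟩ ?_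
    show dist (T.tube (p u) u) (R.boundary u₁) ≤ 2 * ε₀
    linarith [dist_triangle (T.tube (p u) u) (R.boundary u) (R.boundary u₁)]

end Summit.CriticalPhenomena.CardyFormulaZ2.Cruxes.LoopLimitZ2EqT.HexSegment

end
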